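import Summits.MatrixMultiplication.MatrixMultiplication.Theorems.SoloBlindPairRecursion

/-!
# Two pair representations of an H-good target kill every larger layer (solo-blind, door I1⁗ / (K₃), s80)

Setting of `SoloBlindWindowTwo` (`h : ι → G` zero-sum free on `S`, `G` abelian of exponent `3`, `τ` H-good).
`soloBlind_hgood_two_pairs_kill`: if `τ` has TWO pair representations — by `soloBlind_two_pairs_share` they are
`{x, y}` and `{x, q}` with twins `h y = h q` — then `τ` has NO representation of any size `k + 1 ≥ 3`:
a representation through `x` avoids `y, q` (antichain) and its remainder `Q` (sum `h y`) gives the zero-sum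
`Q ∪ {y, q}` (`3·h y = 0`); a representation avoiding `x` contains `y` and `q`, and its remainder plus `x` sums to
`τ + τ`.  Hence on the stratum `N_2(τ) ≥ 2` the whole representation family is `{{x,y}, {x,q}}`
(`soloBlind_hgood_two_pairs_layers`: `N_1 = 0`, `N_2 = 2`, `N_{k+1} = 0` for `k ≥ 2`), i.e. the Kraft mass of an
H-good target with two pair representations is exactly `1/2` — Conjecture E (mass `≤ 1/2` for H-good targets, the
H-good half of (K₃)) holds with equality there, in all ranks and for all layer sizes.  The size-3 case is
`soloBlind_hgood_two_pairs_no_triple` of `SoloBlindWindowThreeLemmas`.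
-/

namespace Summit.MatrixMultiplication.MatrixMultiplication.Theorems

open Finset

variable {ι G : Type*} [DecidableEq ι] [AddCommGroup G] [DecidableEq G]

/-- TWO PAIRS KILL ALL LARGER LAYERS: with pair representations `{x, y}`, `{x, q}` (`y ≠ q`) of an H-good `τ`,
no `(k+1)`-subset of `S` with `k ≥ 2` has `h`-sum `τ`. -/
theorem soloBlind_hgood_two_pairs_kill (three : ∀ g : G, g + g + g = 0) {h : ι → G} {S : Finset ι}
    (zsf : ∀ T ⊆ S, T.Nonempty → ∑ i ∈ T, h i ≠ 0) {τ : G}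
    (hgood : ∀ T ⊆ S, ∑ i ∈ T, h i ≠ τ + τ) {x y q : ι}
    (hP : ({x, y} : Finset ι) ∈ soloBlindSeqRep h S 2 τ) (hP' : ({x, q} : Finset ι) ∈ soloBlindSeqRep h S 2 τ)
    (hyq : y ≠ q) {k : ℕ} (hk : 2 ≤ k) {M : Finset ι} (hM : M ∈ soloBlindSeqRep h S (k + 1) τ) : False := by
  obtain ⟨hPS, hPc, hPsum⟩ := soloBlind_mem_seqRep.mp hP
  obtain ⟨hP'S, hP'c, hP'sum⟩ := soloBlind_mem_seqRep.mp hP'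
  obtain ⟨hMS, hMc, hMsum⟩ := soloBlind_mem_seqRep.mp hM
  have hxy : x ≠ y := by
    intro e; rw [e] at hPc; simp at hPc
  have hxq : x ≠ q := by
    intro e; rw [e] at hP'c; simp at hP'c
  rw [Finset.sum_pair hxy] at hPsum
  rw [Finset.sum_pair hxq] at hP'sum
  have hyS : y ∈ S := hPS (Finset.mem_insert_of_mem (Finset.mem_singleton_self _))
  have hqS : q ∈ S := hP'S (Finset.mem_insert_of_mem (Finset.mem_singleton_self _))
  have hxS : x ∈ S := hPS (Finset.mem_insert_self _ _)
  have hqy : h q = h y := by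
    have e : h x + h q = h x + h y := by rw [hP'sum, hPsum]
    exact add_left_cancel e
  by_cases hxM : x ∈ M
  · -- through x: avoids y and q; the remainder Q has sum h y and Q ∪ {y, q} is a zero-sum
    have hyM : y ∉ M := fun hyM => soloBlind_pair_not_both zsf hP hk hM hxM hyM
    have hqM : q ∉ M := fun hqM => soloBlind_pair_not_both zsf hP' hk hM hxM hqM
    have eQ : ∑ i ∈ M.erase x, h i = h y := by
      have e := Finset.add_sum_erase M h hxM
      rw [hMsum, ← hPsum] at e
      exact add_left_cancel e
    have hyQ : y ∉ insert q (M.erase x) := by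
      rw [Finset.mem_insert]; rintro (e | e)
      · exact hyq e
      · exact hyM (Finset.mem_of_mem_erase e)
    have hqQ : q ∉ M.erase x := fun e => hqM (Finset.mem_of_mem_erase e)
    have hZ : ∑ i ∈ insert y (insert q (M.erase x)), h i = 0 := by
      rw [Finset.sum_insert hyQ, Finset.sum_insert hqQ, eQ, hqy, ← add_assoc]
      exact three (h y)
    refine zsf _ ?_ (Finset.insert_nonempty _ _) hZ
    exact Finset.insert_subset hyS (Finset.insert_subset hqS ((Finset.erase_subset _ _).trans hMS))
  · -- avoiding x: contains y and q; the remainder plus x sums to τ + τ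
    have meet : ∀ {z : ι}, ({x, z} : Finset ι) ∈ soloBlindSeqRep h S 2 τ → z ∈ M := by
      intro z hPz
      by_contra hzM
      refine soloBlind_hgood_not_disjoint hgood hM hPz (Finset.disjoint_right.mpr ?_)
      intro w hw
      simp only [Finset.mem_insert, Finset.mem_singleton] at hw
      rcases hw with hw | hw
      · rw [hw]; exact hxM
      · rw [hw]; exact hzM
    have hyM : y ∈ M := meet hP
    have hqM : q ∈ M := meet hP'
    have hqMy : q ∈ M.erase y := Finset.mem_erase.mpr ⟨fun e => hyq e.symm, hqM⟩
    have eR : h y + (h q + ∑ i ∈ (M.erase y).erase q, h i) = τ := by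
      rw [Finset.add_sum_erase _ h hqMy, Finset.add_sum_erase _ h hyM, hMsum]
    have hxR : x ∉ (M.erase y).erase q := fun e =>
      hxM (Finset.mem_of_mem_erase (Finset.mem_of_mem_erase e))
    have hW : ∑ i ∈ insert x ((M.erase y).erase q), h i = τ + τ := by
      rw [Finset.sum_insert hxR]
      have e5 : h x + ∑ i ∈ (M.erase y).erase q, h i =
          (h x + h y) + (h y + (h q + ∑ i ∈ (M.erase y).erase q, h i)) - (h y + h y + h q) := by abel
      rw [e5, hPsum, eR, hqy, three (h y), sub_zero]
    refine hgood _ ?_ hW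
    exact Finset.insert_subset hxS
      (((Finset.erase_subset _ _).trans (Finset.erase_subset _ _)).trans hMS)

/-- On the stratum `N_2(τ) ≥ 2` of an H-good target the representation family is exactly the two pairs:
`N_1(τ) = 0`, `N_2(τ) = 2` and `N_{k+1}(τ) = 0` for every `k ≥ 2` (Kraft mass exactly `1/2`). -/
theorem soloBlind_hgood_two_pairs_layers (three : ∀ g : G, g + g + g = 0) (h : ι → G) (S : Finset ι)
    (zsf : ∀ T ⊆ S, T.Nonempty → ∑ i ∈ T, h i ≠ 0) (τ : G)
    (hgood : ∀ T ⊆ S, ∑ i ∈ T, h i ≠ τ + τ) (h2 : 2 ≤ (soloBlindSeqRep h S 2 τ).card) :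
    (soloBlindSeqRep h S 1 τ).card = 0 ∧ (soloBlindSeqRep h S 2 τ).card = 2 ∧
      ∀ k : ℕ, 2 ≤ k → (soloBlindSeqRep h S (k + 1) τ).card = 0 := by
  have hw3 := soloBlind_window_three_off_diagonal three h S zsf τ hgood (Or.inr (by omega))
  refine ⟨by omega, by omega, fun k hk => ?_⟩
  obtain ⟨Q₁, hQ₁, Q₂, hQ₂, hne⟩ := Finset.one_lt_card.mp h2
  have hnd : ¬ Disjoint Q₁ Q₂ := fun hd => soloBlind_hgood_not_disjoint hgood hQ₁ hQ₂ hd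
  obtain ⟨u, u', v, -, -, -, huu', -, -, -, -, rfl, rfl⟩ := soloBlind_two_pairs_share hQ₁ hQ₂ hne hnd
  rw [Finset.card_eq_zero, Finset.eq_empty_iff_forall_notMem]
  intro M hM
  rw [Finset.pair_comm u v] at hQ₁
  rw [Finset.pair_comm u' v] at hQ₂
  exact soloBlind_hgood_two_pairs_kill three zsf hgood hQ₁ hQ₂ huu' hk hM

end Summit.MatrixMultiplication.MatrixMultiplication.Theorems
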